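import Summits.AtomisticToContinuum.FouriersLaw.Theorems.BondHeatUncertaintyLightConeBondHeatTentStatics

/-!
# (S) `SubdiffusiveBondHeat` from the Einstein–Helfand ceiling of the block current of the OPEN chain

Support file for crux `stmt-AtomisticToContinuum-9120` (`BondHeatUncertainty.SubdiffusiveBondHeat`, (S)); line lead c2,
2026-08-17.  The BULK-BOND form of the crux's `N`-uniform kernel, recorded as a sorry-free transfer next to the contact form
`subdiffusiveBondHeat_of_deficitCesaroEW` (`…SubdiffusiveBondHeatOfDeficitCesaroEW`): the tent reduction
`pinnedChain_bondHeatVar_le_tent` (`…LightConeBondHeatTentReduction`) with its `N`-uniform statics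
`pinnedChain_tentEnergy_variance_le` (`…LightConeBondHeatTentStatics`) bounds the equilibrium bond-heat variance at bond `0` by
`(2/(L+1)²)·V_N^J(t) + 8c(L+1)`, `V_N^J(t) = 2∫₀ᵗ (t-s) ∫ J·P_sJ dμ_T`, `J = ∑_{0 ≤ k ≤ L} j_k`; an `N`-uniform diffusive
(Einstein–Helfand) ceiling `V_N^J(t) ≤ C(1+t)(L+1)` for the block functional of the OPEN chain — VERBATIM the hypothesis of
the landed `lightConeBondHeat_of_openBlockDiffusion`, the open-chain twin of crux `OddSectorIrreversibility.SubBallisticWindow`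
(stmt-AtomisticToContinuum-14070, stated there for the closed Hamiltonian flow) — then gives, with the tent length `L = ⌊√t⌋`,
`V_N(0,t) ≤ (4C⁺ + 16c⁺)√t` as long as the tent fits, `⌊√t⌋ + 1 < N`; the Thouless window `t ≤ N²/4` (`√t ≤ N/2`) keeps it
fitting for `N ≥ 3`.  So ONE supplier statement serves (S_lc) (window `t ≤ N`) and (S) (window `t ≤ N²/4`) alike: at the
level of this reduction the light cone plays no role, and all `N`-uniform dynamical content of (S) at a bulk bond is the
block ceiling on `[0, cN²]` (which at `t → ∞` also contains `G_N = O(1/N)` through the flat Kubo identity, as (S) must —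
`Cruxes/SubdiffusiveBondHeat/Disproof.lean` §4/§7).  Nothing here closes an item; the hypothesis is not an item of the route.
-/

noncomputable section

open MeasureTheory Filter Topology Set intervalIntegral
open scoped NNReal ENNReal

namespace Summit.AtomisticToContinuum.FouriersLaw.Theorems.SubdiffusiveBondHeat

open Literature.MathematicalPhysics.KineticTheory.HeatConduction
open Literature.MathematicalPhysics.KineticTheory Literature.Probability.Process OscillatorChain
open Summit.AtomisticToContinuum.FouriersLaw.Theorems.SubBallisticWindow.Negative.ClosedFlow
open Summit.AtomisticToContinuum.FouriersLaw.Theorems.LightConeBondHeat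
open Summit.AtomisticToContinuum.FouriersLaw.Theses.BondHeatUncertainty

/-- **(S) from an `N`-uniform diffusive bound on the block-current functional of the open chain.**  Suppose that for the
pinned anharmonic chain (all parameters `> 0`) and every `T > 0` there is `C` such that for every `N`, every block `[b₀, b₀+L]`
of bonds with `b₀ + L + 1 < N` and every `t ≥ 0` the equilibrium block functional of the OPEN chain (constructed kernels
`transitionKernel N T T`, Gibbs state `gibbsMeasure N T`) obeys the Einstein–Helfand ceiling
`2∫₀ᵗ (t-s) ∫ J · P_s J dμ_T ds ≤ C (1 + t)(L + 1)`, `J = ∑_{b₀ ≤ k ≤ b₀+L} j_k` (verbatim the hypothesis of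
`lightConeBondHeat_of_openBlockDiffusion`).  Then `SubdiffusiveBondHeat` holds with the bath-adjacent bond `b = 0`, Thouless
constant `c = 1/4`, `N₀ = 3` and `A = 4 max(C,0) + 16 max(c,0)` (`c` the static constant of
`pinnedChain_tentEnergy_variance_le`): for `1 ≤ t ≤ N²/4` the tent of length `L = ⌊√t⌋ ≤ N/2` to the right of bond `0` fits
(`L + 1 < N` since `N ≥ 3`), the block term is `(2/(L+1)²)·C(1+t)(L+1) ≤ 2C(1+t)/√t ≤ 4C√t` and the static term is
`8c(L+1) ≤ 16c√t`. [folklore] -/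
theorem subdiffusiveBondHeat_of_openBlockDiffusion :
    (∀ ω₂ lam β γ : ℝ, 0 < ω₂ → 0 < lam → 0 < β → 0 < γ → ∀ T : ℝ, 0 < T → ∃ C : ℝ, ∀ (N b₀ L : ℕ), b₀ + L + 1 < N → ∀ t : ℝ, 0 ≤ t → 2 * ∫ s in (0 : ℝ)..t, (t - s) * ∫ z, (∑ k : Fin N, (if b₀ ≤ k.val ∧ k.val ≤ b₀ + L then (Literature.MathematicalPhysics.KineticTheory.HeatConduction.pinnedChain ω₂ lam β γ).bondCurrent N k z else 0)) * (∫ y, (∑ k : Fin N, (if b₀ ≤ k.val ∧ k.val ≤ b₀ + L then (Literature.MathematicalPhysics.KineticTheory.HeatConduction.pinnedChain ω₂ lam β γ).bondCurrent N k y else 0)) ∂((Literature.MathematicalPhysics.KineticTheory.HeatConduction.pinnedChain ω₂ lam β γ).transitionKernel N T T s.toNNReal z)) ∂((Literature.MathematicalPhysics.KineticTheory.HeatConduction.pinnedChain ω₂ lam β γ).gibbsMeasure N T) ≤ C * (1 + t) * ((L : ℝ) + 1)) → Summit.AtomisticToContinuum.FouriersLaw.Theses.BondHeatUncertainty.SubdiffusiveBondHeat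 := by
  intro hD ω₂ lam β γ hω hl hβ hγ T hT
  simp only []
  obtain ⟨C, hC⟩ := hD ω₂ lam β γ hω hl hβ hγ T hT
  obtain ⟨c, hc⟩ := pinnedChain_tentEnergy_variance_le hω hl.le hβ.le γ hT
  set C' : ℝ := max C 0 with hC'
  set c' : ℝ := max c 0 with hc'
  have hC'0 : 0 ≤ C' := le_max_right _ _
  have hc'0 : 0 ≤ c' := le_max_right _ _
  refine ⟨4 * C' + 16 * c', 1 / 4, by norm_num, 3, fun N hN => ⟨0, by omega, fun t ht1 htN => ?_⟩⟩
  have ht0 : 0 ≤ t := by linarith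
  -- the block length `L = ⌊√t⌋`
  set L : ℕ := ⌊Real.sqrt t⌋₊ with hL
  have hst1 : 1 ≤ Real.sqrt t := by rw [Real.le_sqrt' one_pos]; simpa using ht1
  have hst0 : 0 ≤ Real.sqrt t := Real.sqrt_nonneg _
  have hLle : (L : ℝ) ≤ Real.sqrt t := Nat.floor_le hst0
  have hLlt : Real.sqrt t < (L : ℝ) + 1 := Nat.lt_floor_add_one _
  have hN3 : (3 : ℝ) ≤ (N : ℝ) := by exact_mod_cast hN
  -- the Thouless window `t ≤ N²/4` gives `√t ≤ N/2`, so the tent fits: `L + 1 ≤ N/2 + 1 < N`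
  have hsN : Real.sqrt t ≤ (N : ℝ) / 2 := by
    have h1 : t ≤ ((N : ℝ) / 2) ^ 2 := by nlinarith [htN]
    have h2 : Real.sqrt t ≤ Real.sqrt (((N : ℝ) / 2) ^ 2) := Real.sqrt_le_sqrt h1
    rwa [Real.sqrt_sq (by positivity)] at h2
  have hbL : 0 + L + 1 < N := by
    have h1 : (L : ℝ) + 1 < (N : ℝ) := by linarith
    have h2 : L + 1 < N := by exact_mod_cast h1
    omega
  have hN0 : 0 < N := by omega
  simp only [dif_pos hN0]
  -- the tent reduction at bond `0` with block length `L`, centred at the mean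
  have key := pinnedChain_bondHeatVar_le_tent hω hl.le hβ hγ hT hbL ht0
    (∫ y, weightedEnergy (pinnedChain ω₂ lam β γ)
      (fun k : ℕ => if 0 < k ∧ k ≤ 0 + L then ((0 : ℕ) + (L : ℝ) + 1 - k) / (L + 1) else 0) N y
      ∂((pinnedChain ω₂ lam β γ).gibbsMeasure N T))
  have hJ := hC N 0 L hbL t ht0
  have hW := hc N 0 L
  have hL1 : (0 : ℝ) < (L : ℝ) + 1 := by positivity
  -- the block term: `(2/(L+1)²)·C(1+t)(L+1) ≤ 4 C' √t`
  have hblock : 2 / ((L : ℝ) + 1) ^ 2 * (C * (1 + t) * ((L : ℝ) + 1)) ≤ 4 * C' * Real.sqrt t := by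
    have h1 : C * (1 + t) * ((L : ℝ) + 1) ≤ C' * (1 + t) * ((L : ℝ) + 1) := by
      apply mul_le_mul_of_nonneg_right _ hL1.le
      exact mul_le_mul_of_nonneg_right (le_max_left _ _) (by linarith)
    have h2 : 2 / ((L : ℝ) + 1) ^ 2 * (C' * (1 + t) * ((L : ℝ) + 1)) = 2 * C' * (1 + t) / ((L : ℝ) + 1) := by
      field_simp
    have h3 : 2 * C' * (1 + t) / ((L : ℝ) + 1) ≤ 2 * C' * (1 + t) / Real.sqrt t :=
      div_le_div_of_nonneg_left (by positivity) (by positivity) hLlt.le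
    have h4 : 2 * C' * (1 + t) / Real.sqrt t ≤ 4 * C' * Real.sqrt t := by
      rw [div_le_iff₀ (by positivity)]
      have hsq : Real.sqrt t * Real.sqrt t = t := Real.mul_self_sqrt ht0
      nlinarith [hsq, hC'0]
    calc 2 / ((L : ℝ) + 1) ^ 2 * (C * (1 + t) * ((L : ℝ) + 1))
        ≤ 2 / ((L : ℝ) + 1) ^ 2 * (C' * (1 + t) * ((L : ℝ) + 1)) :=
          mul_le_mul_of_nonneg_left h1 (by positivity)
      _ = 2 * C' * (1 + t) / ((L : ℝ) + 1) := h2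
      _ ≤ 2 * C' * (1 + t) / Real.sqrt t := h3
      _ ≤ 4 * C' * Real.sqrt t := h4
  -- the static term: `8 c (L+1) ≤ 16 c' √t`
  have hstat : 8 * (c * ((L : ℝ) + 1)) ≤ 16 * c' * Real.sqrt t := by
    have h1 : c * ((L : ℝ) + 1) ≤ c' * ((L : ℝ) + 1) := mul_le_mul_of_nonneg_right (le_max_left _ _) hL1.le
    have h2 : (L : ℝ) + 1 ≤ 2 * Real.sqrt t := by linarith
    nlinarith [mul_le_mul_of_nonneg_left h2 hc'0]
  have hV := key.trans (add_le_add (mul_le_mul_of_nonneg_left hJ (by positivity)) (mul_le_mul_of_nonneg_left hW (by norm_num)))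
  calc _ ≤ _ := hV
    _ ≤ 4 * C' * Real.sqrt t + 16 * c' * Real.sqrt t := add_le_add hblock hstat
    _ = (4 * C' + 16 * c') * Real.sqrt t := by ring

end Summit.AtomisticToContinuum.FouriersLaw.Theorems.SubdiffusiveBondHeat

end
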